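import Summits.ValiantsHypothesis.ValiantsHypothesis.Theorems.KPlusLogSqLawTropicalGradedWalkDomXGlue1

/-!
# Dominance glue (type X), part 3: the lowered block column `b = u − 1`

GRW-lite `K = 4` graded-walk family (census side of the tropical root law, all `m`):
dominance glue for the EXCURSION states `(w, u, 1)`, `2 ≤ u ≤ w − 1 < m − 1`, of the design typed in
`KPlusLogSqLawTropicalGradedWalkDefs` (Leibniz term: the diagonal term of `(w, u, 0)` with the rows of the columns
`u − 1`, `u` exchanged).  This part dispatches an arbitrary rival `(a, u − 1, l)` of the LOWERED column `u − 1`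
(intended incidence: row `R₂ = m − w + u`, class `3`, level `w − 1`) to its slack family of `…DomX2` / `…DomX3`
(far rivals are first reduced to the best class of their level by the generic lifts of `…GradedWalkLift`).

Honest framing: this is a census-side (lower-bound) construction — a quadratic family of
distinct optimal slopes for `TropRootLawAt (n+1) 4`.  It says nothing about `TropicalB` inside
its window and nothing about VP ≠ VNP.
-/

set_option linter.dupNamespace false
set_option autoImplicit false

namespace Summit.ValiantsHypothesis.ValiantsHypothesis.Theorems.LacunarySymmetroidMatrixDescartes.TropicalCensus

namespace GradedWalk

open Summit.ValiantsHypothesis.ValiantsHypothesis.Theorems.MatrixDescartes.Negative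

variable (n : ℕ)

/-! ### slack, the lowered column `b = u − 1` -/

set_option maxHeartbeats 400000 in
/-- slack of the type-X certificate: the lowered block column `b = u − 1`. -/
theorem slackX_um1 (w u : ℕ) (hu2 : 2 ≤ u) (huw : u < w) (hwn : w ≤ n) (a b : Fin (n + 1)) (l : Fin 4)
    (hp : ee n a b l ≠ 0) (hne : perm n w u 1 b ≠ a ∨ lam n w u 1 b ≠ l) (hbu : (b : ℕ) + 1 = u) :
    1 * (thX n w u * (dd n l : ℤ) - vv n a b l) <
      UX n w u a + ((thX n w u * (dd n (lam n w u 1 b) : ℤ) - vv n (perm n w u 1 b) b (lam n w u 1 b)) - UX n w u (perm n w u 1 b)) := by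
  have hw1 : w ≤ n + 1 := by omega
  have han : (a : ℕ) ≤ n := Nat.lt_succ_iff.mp a.isLt
  have hbn : (b : ℕ) ≤ n := Nat.lt_succ_iff.mp b.isLt
  have hbv : (b : ℕ) = u - 1 := by omega
  have hr : ((perm n w u 1 b : Fin (n + 1)) : ℕ) = n + 1 - w + u := sigmaX_um1 n huw hw1 b hbu
  rw [lam_X n huw] at hne ⊢
  rw [if_neg (show ¬ w ≤ (b : ℕ) by omega), if_neg (show ¬ ((b : ℕ) + 1 < u) by omega),
    if_pos (show (b : ℕ) < u by omega)] at hne ⊢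
  have hlowr : (b : ℕ) < ((perm n w u 1 b : Fin (n + 1)) : ℕ) := by rw [hr]; omega
  have hEr : n + 1 + (b : ℕ) - (n + 1 - w + u) = w - 1 := by omega
  have hwne : w - 1 ≠ n + 1 := by omega
  have hT3 : thX n w u * (dd n 3 : ℤ) - vv n (perm n w u 1 b) b 3 =
      thX n w u * d3 n - ((v1 n (w - 1) (u - 1) + bB n * tau2lt n (w - 1) (u - 1)) + tau3lt n (w - 1) (u - 1)) := by
    rw [dd_cast_three, vv_lower n hlowr, hr, hEr, vblk_three, tau2_of_ne n hwne, tau3_of_ne n hwne, hbv]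
  have hUr : UX n w u ((perm n w u 1 b : Fin (n + 1)) : ℕ) = gG n * thX n w u * (((n + 1 - w + (u)) : ℕ) : ℤ) + SXR2 n w u := by
    rw [hr]; unfold UX; rw [show n + 1 - w + u - (n + 1 - w) = u by omega, muX_R2]
  rcases Nat.lt_or_ge (a : ℕ) (b : ℕ) with hab | hba
  · -- wrap cells above the diagonal: classes 0 / 1
    have hl : l = 0 ∨ l = 1 := by
      rcases (show l = 0 ∨ l = 1 ∨ l = 2 ∨ l = 3 by fin_cases l <;> simp) with rfl | rfl | rfl | rfl
      · exact Or.inl rfl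
      · exact Or.inr rfl
      · exact absurd (ee_upper_ge_two n hab 2 (by decide)) hp
      · exact absurd (ee_upper_ge_two n hab 3 (by decide)) hp
    rcases hl with rfl | rfl
    · rcases Nat.eq_zero_or_pos (a : ℕ) with ha0 | ha0
      · have hc : (((((u - 1)) - (0) : ℕ)) : ℤ) = (((b : ℕ)) : ℤ) - (((a : ℕ)) : ℤ) := by
          rw [hbv, ha0, Nat.sub_zero]; push_cast [Nat.cast_sub (show 1 ≤ u by omega)]; ring
        have hX : thX n w u * (dd n 0 : ℤ) - vv n a b 0 = ((0 : ℤ) - 4 * mZ n * gG n ^ 2 * ((((u - 1) - (0)) : ℕ) : ℤ) ^ 2) := by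
          rw [dd_cast_zero, vv_upper_zero n hab, hc]; ring
        have hY : UX n w u a - UX n w u ((perm n w u 1 b : Fin (n + 1)) : ℕ) = ((0 : ℤ) - (gG n * thX n w u * (((n + 1 - w + (u)) : ℕ) : ℤ) + SXR2 n w u)) := by
          rw [hUr]; unfold UX; rw [ha0, Nat.zero_sub, muX_zero n hu2]; simp
        exact slack_of (X_um1_w0_R0 n w u (by omega) (by omega) (by omega)) hX hT3 hY
      · rcases Nat.lt_or_ge (n + 1 - w) (a : ℕ) with hblk | hpl
        · obtain ⟨jp, hjp⟩ : ∃ jp, (a : ℕ) = (n + 1 - w) + jp := ⟨(a : ℕ) - (n + 1 - w), by omega⟩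
          have hc : (((((u - 1)) - ((n + 1 - w) + jp) : ℕ)) : ℤ) = (((b : ℕ)) : ℤ) - (((a : ℕ)) : ℤ) := by
            rw [hbv, hjp]; push_cast [Nat.cast_sub (show (n + 1 - w) + jp ≤ u - 1 by omega)]; ring
          have hX : thX n w u * (dd n 0 : ℤ) - vv n a b 0 = ((0 : ℤ) - 4 * mZ n * gG n ^ 2 * (((((u - 1)) - ((n + 1 - w) + jp)) : ℕ) : ℤ) ^ 2) := by
            rw [dd_cast_zero, vv_upper_zero n hab, hc]; ring
          have hY : UX n w u a - UX n w u ((perm n w u 1 b : Fin (n + 1)) : ℕ) = ((gG n * thX n w u * ((((n + 1 - w) + (jp)) : ℕ) : ℤ) + SX2 n w u (jp)) - (gG n * thX n w u * (((n + 1 - w + (u)) : ℕ) : ℤ) + SXR2 n w u)) := by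
            rw [hUr]; unfold UX; rw [show (a : ℕ) - (n + 1 - w) = jp by omega, muX_lt n (by omega), hjp]
          exact slack_of (X_um1_w0_B n w u jp ((n + 1 - w)) (by omega) (by omega) (by omega) (by omega) (by omega)) hX hT3 hY
        · have hc : (((((u - 1)) - ((a : ℕ)) : ℕ)) : ℤ) = (((b : ℕ)) : ℤ) - (((a : ℕ)) : ℤ) := by
            rw [hbv]; push_cast [Nat.cast_sub (show (a : ℕ) ≤ u - 1 by omega)]; ring
          have hX : thX n w u * (dd n 0 : ℤ) - vv n a b 0 = ((0 : ℤ) - 4 * mZ n * gG n ^ 2 * (((((u - 1)) - ((a : ℕ))) : ℕ) : ℤ) ^ 2) := by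
            rw [dd_cast_zero, vv_upper_zero n hab, hc]; ring
          have hY : UX n w u a - UX n w u ((perm n w u 1 b : Fin (n + 1)) : ℕ) = (gG n * thX n w u * (((a) : ℕ) : ℤ) - (gG n * thX n w u * (((n + 1 - w + (u)) : ℕ) : ℤ) + SXR2 n w u)) := by
            rw [hUr]; unfold UX; rw [show (a : ℕ) - (n + 1 - w) = 0 by omega, muX_zero n hu2]; simp
          exact slack_of (X_um1_w0_P n w u a (by omega) (by omega) (by omega) (by omega)) hX hT3 hY
    · rcases Nat.eq_zero_or_pos (a : ℕ) with ha0 | ha0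
      · have hX : thX n w u * (dd n 1 : ℤ) - vv n a b 1 = (thX n w u * d1 n - conn n (((u - 1)) - (0)) ((u - 1))) := by
          rw [dd_cast_one, vv_upper_one n hab, ha0, hbv]
        have hY : UX n w u a - UX n w u ((perm n w u 1 b : Fin (n + 1)) : ℕ) = ((0 : ℤ) - (gG n * thX n w u * (((n + 1 - w + (u)) : ℕ) : ℤ) + SXR2 n w u)) := by
          rw [hUr]; unfold UX; rw [ha0, Nat.zero_sub, muX_zero n hu2]; simp
        exact slack_of (X_um1_cn_R0 n w u (by omega) (by omega) (by omega)) hX hT3 hY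
      · rcases Nat.lt_or_ge (n + 1 - w) (a : ℕ) with hblk | hpl
        · obtain ⟨jp, hjp⟩ : ∃ jp, (a : ℕ) = (n + 1 - w) + jp := ⟨(a : ℕ) - (n + 1 - w), by omega⟩
          have hX : thX n w u * (dd n 1 : ℤ) - vv n a b 1 = (thX n w u * d1 n - conn n (((u - 1)) - ((n + 1 - w) + jp)) ((u - 1))) := by
            rw [dd_cast_one, vv_upper_one n hab, hjp, hbv]
          have hY : UX n w u a - UX n w u ((perm n w u 1 b : Fin (n + 1)) : ℕ) = ((gG n * thX n w u * ((((n + 1 - w) + (jp)) : ℕ) : ℤ) + SX2 n w u (jp)) - (gG n * thX n w u * (((n + 1 - w + (u)) : ℕ) : ℤ) + SXR2 n w u)) := by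
            rw [hUr]; unfold UX; rw [show (a : ℕ) - (n + 1 - w) = jp by omega, muX_lt n (by omega), hjp]
          exact slack_of (X_um1_cn_B n w u jp ((n + 1 - w)) (by omega) (by omega) (by omega) (by omega) (by omega)) hX hT3 hY
        · have hX : thX n w u * (dd n 1 : ℤ) - vv n a b 1 = (thX n w u * d1 n - conn n (((u - 1)) - ((a : ℕ))) ((u - 1))) := by
            rw [dd_cast_one, vv_upper_one n hab, hbv]
          have hY : UX n w u a - UX n w u ((perm n w u 1 b : Fin (n + 1)) : ℕ) = (gG n * thX n w u * (((a) : ℕ) : ℤ) - (gG n * thX n w u * (((n + 1 - w + (u)) : ℕ) : ℤ) + SXR2 n w u)) := by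
            rw [hUr]; unfold UX; rw [show (a : ℕ) - (n + 1 - w) = 0 by omega, muX_zero n hu2]; simp
          exact slack_of (X_um1_cn_P n w u a (by omega) (by omega) (by omega) (by omega)) hX hT3 hY
  rcases Nat.lt_or_ge (a : ℕ) ((n + 1 - w + u) - 1) with halt | hge
  · -- between the diagonal (included) and the row `R₁` (excluded): future levels `w + k`, class 1 best; or the diagonal class-0 cell
    obtain ⟨k, hk⟩ : ∃ k, (a : ℕ) + k = n + 1 - w + u - 1 := ⟨n + 1 - w + u - 1 - (a : ℕ), by omega⟩
    have hk1 : 1 ≤ k := by omega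
    have hkle : k ≤ n + 1 - w := by omega
    rcases Nat.eq_or_lt_of_le hba with hab | hab
    · -- diagonal (`k = m − w`)
      have hab' : (a : ℕ) = (b : ℕ) := hab.symm
      have hkq : n + 1 = k + w := by omega
      by_cases hcl : l = 0
      · subst hcl
        have hX0 : thX n w u * (dd n 0 : ℤ) - vv n a b 0 = thX n w u * 0 - 0 := by rw [dd_cast_zero, vv_diag_zero n hab']
        rcases Nat.lt_or_ge (n + 1 - w) (b : ℕ) with hblk | hpl
        · obtain ⟨jp, hjp⟩ : ∃ jp, (b : ℕ) = (n + 1 - w) + jp := ⟨(b : ℕ) - (n + 1 - w), by omega⟩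
          have hu : u = (n + 1 - w) + jp + 1 := by omega
          subst hu
          have hY : UX n w ((n + 1 - w) + jp + 1) a - UX n w ((n + 1 - w) + jp + 1) ((perm n w ((n + 1 - w) + jp + 1) 1 b : Fin (n + 1)) : ℕ) =
              ((gG n * thX n w ((n + 1 - w) + jp + 1) * ((((n + 1 - w) + (jp)) : ℕ) : ℤ) + SX2 n w ((n + 1 - w) + jp + 1) (jp)) -
                (gG n * thX n w ((n + 1 - w) + jp + 1) * (((n + 1 - w + (((n + 1 - w) + jp + 1))) : ℕ) : ℤ) + SXR2 n w ((n + 1 - w) + jp + 1))) := by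
            rw [hUr, hab', hjp]; unfold UX; rw [show n + 1 - w + jp - (n + 1 - w) = jp by omega, muX_lt n (by omega)]
          have hF := X_um1_dg0_B n w jp ((n + 1 - w)) (by omega) (by omega) (by omega) (by omega)
          rw [show (n + 1 - w) + jp + 1 - 1 = (n + 1 - w) + jp by omega] at hF
          rw [show (n + 1 - w) + jp + 1 - 1 = (n + 1 - w) + jp by omega] at hT3
          exact slack_of hF hX0 hT3 hY
        · have hY : UX n w u a - UX n w u ((perm n w u 1 b : Fin (n + 1)) : ℕ) = (gG n * thX n w u * (((u - 1) : ℕ) : ℤ) - (gG n * thX n w u * (((n + 1 - w + (u)) : ℕ) : ℤ) + SXR2 n w u)) := by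
            rw [hUr, hab', hbv]; unfold UX; rw [show (u - 1) - (n + 1 - w) = 0 by omega, muX_zero n hu2]; simp
          exact slack_of (X_um1_dg0_P n w u (by omega) (by omega) (by omega)) hX0 hT3 hY
      · have hθ : thX n w u ≤ LL n * ((n : ℤ) + 1) := thX_le_top n huw hwn
        have hX1 : thX n w u * (dd n 1 : ℤ) - vv n a b 1 = thX n w u * d1 n - v1 n (n + 1) (u - 1) := by
          rw [dd_cast_one, vv_diag n hab' 1 (by decide), vblk_one, hbv]
        have hXl : thX n w u * (dd n l : ℤ) - vv n a b l + 1 ≤ thX n w u * d1 n - v1 n (n + 1) (u - 1) + 1 ∨ l = 1 := by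
          rcases (show l = 0 ∨ l = 1 ∨ l = 2 ∨ l = 3 by fin_cases l <;> simp) with rfl | rfl | rfl | rfl
          · exact absurd rfl hcl
          · exact Or.inr rfl
          · left; rw [dd_cast_two, vv_diag n hab' 2 (by decide), vblk_two, hbv]
            linarith [lift_fut2_top n (θ := thX n w u) (u - 1) hθ]
          · left; rw [dd_cast_three, vv_diag n hab' 3 (by decide), vblk_three, hbv]
            linarith [lift_fut3_top n (θ := thX n w u) (u - 1) hθ]
        have hXl : thX n w u * (dd n l : ℤ) - vv n a b l ≤ thX n w u * d1 n - v1 n (n + 1) (u - 1) := by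
          rcases hXl with h | rfl
          · linarith
          · exact le_of_eq hX1
        clear hX1
        rcases Nat.lt_or_ge u (k + 1) with hku | hku
        · -- pre-block diagonal row (`u ≤ k`)
          have hY : UX n w u a - UX n w u ((perm n w u 1 b : Fin (n + 1)) : ℕ) = (gG n * thX n w u * (((n + 1 - w + u - 1 - k) : ℕ) : ℤ) - (gG n * thX n w u * (((n + 1 - w + (u)) : ℕ) : ℤ) + SXR2 n w u)) := by
            rw [hUr]; unfold UX; rw [show (a : ℕ) - (n + 1 - w) = 0 by omega, muX_zero n hu2, show (a : ℕ) = n + 1 - w + u - 1 - k by omega]; ring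
          exact slack_le (X_um1_up_P_m n w u k (by omega) (by omega) (by omega) hkq) hXl hT3 hY
        · have hY : UX n w u a - UX n w u ((perm n w u 1 b : Fin (n + 1)) : ℕ) = ((gG n * thX n w u * (((n + 1 - w + (u - 1 - k)) : ℕ) : ℤ) + SX2 n w u (u - 1 - k)) - (gG n * thX n w u * (((n + 1 - w + (u)) : ℕ) : ℤ) + SXR2 n w u)) := by
            rw [hUr]; unfold UX; rw [show (a : ℕ) - (n + 1 - w) = u - 1 - k by omega, muX_lt n (by omega), show (a : ℕ) = n + 1 - w + (u - 1 - k) by omega]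
          exact slack_le (X_um1_up_A_m n w u k (by omega) (by omega) (by omega) hkq) hXl hT3 hY
    · -- strictly between: level `w + k ≤ n`
      have hlow : (b : ℕ) < (a : ℕ) := hab
      have hEa : n + 1 + (b : ℕ) - (a : ℕ) = w + k := by omega
      have hne1 : w + k ≠ n + 1 := by omega
      have hkn : k + w ≤ n := by omega
      have hθ : thX n w u ≤ LL n * ((w + k : ℕ) : ℤ) := thX_le_LE n huw hwn (by omega)
      have hcl : l ≠ 0 := fun h0 => by subst h0; exact hp (ee_lower_zero n hlow)
      have hX1 : thX n w u * (dd n 1 : ℤ) - vv n a b 1 = thX n w u * d1 n - v1 n (w + k) (u - 1) := by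
        rw [dd_cast_one, vv_lower n hlow, hEa, vblk_one, hbv]
      have hXl : thX n w u * (dd n l : ℤ) - vv n a b l + 1 ≤ thX n w u * d1 n - v1 n (w + k) (u - 1) + 1 ∨ l = 1 := by
        rcases (show l = 0 ∨ l = 1 ∨ l = 2 ∨ l = 3 by fin_cases l <;> simp) with rfl | rfl | rfl | rfl
        · exact absurd rfl hcl
        · exact Or.inr rfl
        · left; rw [dd_cast_two, vv_lower n hlow, hEa, vblk_two, tau2_of_ne n hne1, hbv]
          linarith [lift_fut2 n (θ := thX n w u) (E := w + k) (u - 1) hθ]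
        · left; rw [dd_cast_three, vv_lower n hlow, hEa, vblk_three, tau2_of_ne n hne1, tau3_of_ne n hne1, hbv]
          linarith [lift_fut3 n (θ := thX n w u) (E := w + k) (u - 1) hθ]
      have hXl : thX n w u * (dd n l : ℤ) - vv n a b l ≤ thX n w u * d1 n - v1 n (w + k) (u - 1) := by
        rcases hXl with h | rfl
        · linarith
        · exact le_of_eq hX1
      clear hX1
      rcases Nat.lt_or_ge u (k + 1) with hku | hku
      · have hY : UX n w u a - UX n w u ((perm n w u 1 b : Fin (n + 1)) : ℕ) = (gG n * thX n w u * (((n + 1 - w + u - 1 - k) : ℕ) : ℤ) - (gG n * thX n w u * (((n + 1 - w + (u)) : ℕ) : ℤ) + SXR2 n w u)) := by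
          rw [hUr]; unfold UX; rw [show (a : ℕ) - (n + 1 - w) = 0 by omega, muX_zero n hu2, show (a : ℕ) = n + 1 - w + u - 1 - k by omega]; ring
        exact slack_le (X_um1_up_P_lt n w u k (by omega) (by omega) (by omega) hkn) hXl hT3 hY
      · have hY : UX n w u a - UX n w u ((perm n w u 1 b : Fin (n + 1)) : ℕ) = ((gG n * thX n w u * (((n + 1 - w + (u - 1 - k)) : ℕ) : ℤ) + SX2 n w u (u - 1 - k)) - (gG n * thX n w u * (((n + 1 - w + (u)) : ℕ) : ℤ) + SXR2 n w u)) := by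
          rw [hUr]; unfold UX; rw [show (a : ℕ) - (n + 1 - w) = u - 1 - k by omega, muX_lt n (by omega), show (a : ℕ) = n + 1 - w + (u - 1 - k) by omega]
        exact slack_le (X_um1_up_A_lt n w u k (by omega) (by omega) (by omega) hkn) hXl hT3 hY
  have hlow : (b : ℕ) < (a : ℕ) := by omega
  have hcl : l ≠ 0 := fun h0 => by subst h0; exact hp (ee_lower_zero n hlow)
  rcases Nat.lt_trichotomy (a : ℕ) (n + 1 - w + u) with haR1 | haR2 | hagt
  · -- the row `R₁` (level `w`)
    have haR1' : (a : ℕ) = n + 1 - w + u - 1 := by omega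
    have hEa : n + 1 + (b : ℕ) - (a : ℕ) = w := by omega
    have hwne' : w ≠ n + 1 := by omega
    have hY : UX n w u a - UX n w u ((perm n w u 1 b : Fin (n + 1)) : ℕ) = ((gG n * thX n w u * (((n + 1 - w + (u - 1)) : ℕ) : ℤ) + SXR1 n w u) - (gG n * thX n w u * (((n + 1 - w + (u)) : ℕ) : ℤ) + SXR2 n w u)) := by
      rw [hUr]; unfold UX; rw [show (a : ℕ) - (n + 1 - w) = u - 1 by omega, muX_R1 n (show u - 1 + 1 = u by omega), show (a : ℕ) = n + 1 - w + (u - 1) by omega]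
    rcases (show l = 0 ∨ l = 1 ∨ l = 2 ∨ l = 3 by fin_cases l <;> simp) with rfl | rfl | rfl | rfl
    · exact absurd rfl hcl
    · have hX : thX n w u * (dd n 1 : ℤ) - vv n a b 1 = thX n w u * d1 n - v1 n (w) (u - 1) := by
        rw [dd_cast_one, vv_lower n hlow, hEa, vblk_one, hbv]
      exact slack_of (X_um1_R1_l1 n w u (by omega) (by omega) (by omega)) hX hT3 hY
    · have hX : thX n w u * (dd n 2 : ℤ) - vv n a b 2 = thX n w u * d2 n - (v1 n (w) (u - 1) + bB n * tau2lt n (w) (u - 1)) := by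
        rw [dd_cast_two, vv_lower n hlow, hEa, vblk_two, tau2_of_ne n hwne', hbv]
      exact slack_of (X_um1_R1_l2 n w u (by omega) (by omega) (by omega)) hX hT3 hY
    · have hX : thX n w u * (dd n 3 : ℤ) - vv n a b 3 = thX n w u * d3 n - ((v1 n (w) (u - 1) + bB n * tau2lt n (w) (u - 1)) + tau3lt n (w) (u - 1)) := by
        rw [dd_cast_three, vv_lower n hlow, hEa, vblk_three, tau2_of_ne n hwne', tau3_of_ne n hwne', hbv]
      exact slack_of (X_um1_R1_l3 n w u (by omega) (by omega) (by omega)) hX hT3 hY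
  · -- class rivals at the intended cell `R₂` (past level `w − 1`, class 3 best)
    have hrot : perm n w u 1 b = a := Fin.ext (by rw [hr, haR2])
    have hY : UX n w u a - UX n w u ((perm n w u 1 b : Fin (n + 1)) : ℕ) = 0 := by rw [hrot]; ring
    have hEa : n + 1 + (b : ℕ) - (a : ℕ) = w - 1 := by omega
    have hθ : LL n * ((w - 1 : ℕ) + 1) ≤ thX n w u := LE_le_thX n u (by omega)
    rcases (show l = 0 ∨ l = 1 ∨ l = 2 ∨ l = 3 by fin_cases l <;> simp) with rfl | rfl | rfl | rfl
    · exact absurd rfl hcl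
    · have hX : thX n w u * (dd n 1 : ℤ) - vv n a b 1 = thX n w u * d1 n - v1 n (w - 1) (u - 1) := by
        rw [dd_cast_one, vv_lower n hlow, hEa, vblk_one, hbv]
      exact slack_of0 (lift_past1 n (θ := thX n w u) (c := u - 1) (by omega) (by omega) hθ) hX hT3 hY
    · have hX : thX n w u * (dd n 2 : ℤ) - vv n a b 2 = thX n w u * d2 n - (v1 n (w - 1) (u - 1) + bB n * tau2lt n (w - 1) (u - 1)) := by
        rw [dd_cast_two, vv_lower n hlow, hEa, vblk_two, tau2_of_ne n hwne, hbv]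
      exact slack_of0 (lift_past2 n (θ := thX n w u) (c := u - 1) (by omega) (by omega) hθ) hX hT3 hY
    · exact absurd rfl (hne.resolve_left (fun h => h hrot))
  · -- below the intended cell: level `w − 1 − k`, class 3 best
    obtain ⟨k, hk⟩ : ∃ k, (a : ℕ) = (n + 1 - w + u) + k := ⟨(a : ℕ) - (n + 1 - w + u), by omega⟩
    have hk1 : 1 ≤ k := by clear hT3 hUr hEr hwne hlowr hr hbv; omega
    have hkw : u + k + 1 ≤ w := by clear hT3 hUr hEr hwne hlowr hr hbv; omega
    have hEa : n + 1 + (b : ℕ) - (a : ℕ) = w - 1 - k := by clear hT3 hUr hEr hwne hlowr hr; omega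
    have hne3 : w - 1 - k ≠ n + 1 := by clear hT3 hUr hEr hwne hlowr hr hbv hEa; omega
    have hcn : u - 1 ≤ n := by clear hT3 hUr hEr hwne hlowr hr hbv hEa hne3; omega
    have hEn : w - 1 - k ≤ n := by clear hT3 hUr hEr hwne hlowr hr hbv hEa hne3; omega
    have hj : (a : ℕ) - (n + 1 - w) = u + k := by clear hT3 hUr hEr hwne hlowr hr hbv hEa hne3 hcn hEn; omega
    have hθ : LL n * ((w - 1 - k : ℕ) + 1) ≤ thX n w u :=
      LE_le_thX n u (by clear hT3 hUr hEr hwne hlowr hr hEa hne3 hbv hcn hEn hj; omega)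
    have hX3 : thX n w u * (dd n 3 : ℤ) - vv n a b 3 = thX n w u * d3 n - ((v1 n (w - 1 - k) (u - 1) + bB n * tau2lt n (w - 1 - k) (u - 1)) + tau3lt n (w - 1 - k) (u - 1)) := by
      rw [dd_cast_three, vv_lower n hlow, hEa, vblk_three, tau2_of_ne n hne3, tau3_of_ne n hne3, hbv]
    have hlift : thX n w u * (dd n l : ℤ) - vv n a b l + (if l = 3 then 0 else 1) ≤ thX n w u * d3 n - ((v1 n (w - 1 - k) (u - 1) + bB n * tau2lt n (w - 1 - k) (u - 1)) + tau3lt n (w - 1 - k) (u - 1)) := by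
      rcases (show l = 0 ∨ l = 1 ∨ l = 2 ∨ l = 3 by fin_cases l <;> simp) with rfl | rfl | rfl | rfl
      · exact absurd rfl hcl
      · rw [dd_cast_one, vv_lower n hlow, hEa, vblk_one, hbv]
        simp only [show ((1 : Fin 4) = 3) = False by decide, ite_false]
        linarith [lift_past1 n (θ := thX n w u) (c := u - 1) (E := w - 1 - k) hcn hEn hθ]
      · rw [dd_cast_two, vv_lower n hlow, hEa, vblk_two, tau2_of_ne n hne3, hbv]
        simp only [show ((2 : Fin 4) = 3) = False by decide, ite_false]
        linarith [lift_past2 n (θ := thX n w u) (c := u - 1) (E := w - 1 - k) hcn hEn hθ]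
      · rw [hX3]; simp
    clear hX3 hEa hne3 hcn hEn hθ hEr hlowr
    rcases Nat.lt_or_ge k 2 with hk2 | hk2
    · -- `k = 1`: the row `u + 1`
      have hkone : k = 1 := by clear hT3 hUr hlift hr hbv hj; omega
      subst hkone
      have hY : UX n w u a - UX n w u ((perm n w u 1 b : Fin (n + 1)) : ℕ) = (gG n * thX n w u * ((1 : ℕ) : ℤ) + (SXP n w u - SXR2 n w u)) := by
        rw [hUr]; unfold UX; rw [hj, muX_P, hk]; push_cast [Nat.cast_sub hw1]; ring
      have hF := X_um1_down_P n w u hu2 (by clear hT3 hUr hlift hr hbv hj hY; omega) hwn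
      rw [show w - 1 - 1 = w - 2 from (by clear hT3 hUr hlift hr hbv hj hY hF; omega)] at hlift
      exact slack_of (lift_combine hlift hF) rfl hT3 hY
    · have huk : u + 2 ≤ u + k := by clear hT3 hUr hlift hr hbv hj; omega
      have hkw' : (k + u) + 1 ≤ w := by clear hT3 hUr hlift hr hbv hj; omega
      have hY : UX n w u a - UX n w u ((perm n w u 1 b : Fin (n + 1)) : ℕ) = (gG n * thX n w u * ((k : ℕ) : ℤ) + (SXL n w u (u + k) - SXR2 n w u)) := by
        rw [hUr]; unfold UX; rw [hj, muX_ge n huk, hk]; push_cast [Nat.cast_sub hw1]; ring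
      have hF := X_um1_down_ge n w u k hu2 hk2 hkw' hwn
      exact slack_of (lift_combine hlift hF) rfl hT3 hY

end GradedWalk

end Summit.ValiantsHypothesis.ValiantsHypothesis.Theorems.LacunarySymmetroidMatrixDescartes.TropicalCensus
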